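import Mathlib
import HarnessLib
import Literature.Analysis.OperatorTheory.SchurComplementPolynomialBound

/-!
# An explicit polynomial `p` with `1/x ≤ p(x)` on `[c, cmax]` (shifted–scaled Chebyshev residual polynomial)

The polynomially filtered Schur-complement inertia certificate
`Literature.Analysis.OperatorTheory.fromBlocks_dotProduct_nonneg_of_schur_poly_cert` has ONE analytic
hypothesis, `hp : ∀ x ∈ Set.Icc c cmax, 1 / x ≤ p.eval x`, on an otherwise arbitrary real polynomial `p`.
This file discharges it in two kernel-checkable ways.

1. **Explicitly**, by the residual polynomial of the Chebyshev semi-iterative method / the CG error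
   analysis (Golub–Van Loan (2013) §11.2.8, (11.2.30)ff; Golub–Varga (1961)): with the affine map
   `s(x) = (cmax + c − 2x)/(cmax − c)` (`s(c) = 1`, `s(cmax) = −1`, `s(0) = μ := (cmax + c)/(cmax − c) > 1`)
   and `τ := T_n(μ) > 1` (`T_n` the Chebyshev polynomial of the first kind, `n ≥ 1`), the polynomial
   `q_n(x) := T_n(s(x))/τ` has `q_n(0) = 1` and `|q_n| ≤ 1/τ` on `[c, cmax]`; hence `1 − q_n = X · r_n` and
   `p_n := r_n/(1 − 1/τ)` satisfies `x · p_n(x) = (1 − q_n(x))/(1 − 1/τ) ∈ [1, (1 + 1/τ)/(1 − 1/τ)]` on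
   `[c, cmax]`, i.e. `1/x ≤ p_n(x)` with relative excess `≤ (2/τ)/(1 − 1/τ)`, `τ = T_n(μ) = cosh(n · arcosh μ)`.
   All coefficients are rational functions of `(c, cmax)` (rational data ⇒ rational polynomial: the
   certificate verifier recomputes `p_n` exactly by the three-term recurrence).
2. **By certificate**, for an ARBITRARY `p`: the (trivial direction of the) univariate interval
   Positivstellensatz — an identity `X·p − 1 = Σᵢ aᵢ gᵢ² + (X − c)(cmax − X) Σⱼ bⱼ hⱼ²` with `aᵢ, bⱼ ≥ 0`
   gives `1/x ≤ p(x)` on `[c, cmax]` (Markov–Lukács; Blekherman–Parrilo–Thomas (2012) Thm 3.72). The converse (existence of such a representation for every `p` with `X p − 1 ≥ 0` on the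
   interval) is NOT needed and not formalised.

Finally the corollary `fromBlocks_dotProduct_nonneg_of_chebyshev_schur_cert`: the Schur-complement
inertia certificate with `p := chebInvPoly c cmax n` and NO analytic side condition left.

Pure real analysis / algebra of polynomials; every hypothesis explicit; no `sorry`.
-/

namespace Literature.Analysis.ValidatedNumerics

open Polynomial
open scoped Matrix

noncomputable section

/-! ### The affine map `[c, cmax] → [-1, 1]` and the shift parameter `μ` -/

/-- The affine polynomial `s(X) = (cmax + c − 2X)/(cmax − c)`, mapping `c ↦ 1`, `cmax ↦ −1`,
`0 ↦ μ = (cmax + c)/(cmax − c)`. Golub–Van Loan (2013) §11.2.8 (the argument of `c_k` in `p_k`).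
[cite: GolubVanLoan2013, §11.2.8] -/
def chebAffine (c cmax : ℝ) : ℝ[X] :=
  C ((cmax + c) / (cmax - c)) - C (2 / (cmax - c)) * X

/-- The shift parameter `μ = s(0) = (cmax + c)/(cmax − c)` (`> 1` iff `0 < c < cmax`).
[cite: GolubVanLoan2013, §11.2.8] -/
def chebMu (c cmax : ℝ) : ℝ := (cmax + c) / (cmax - c)

/-- `τ = T_n(μ)`, the Chebyshev amplification factor (`= cosh (n · arcosh μ) > 1` for `n ≥ 1`, `μ > 1`).
[cite: GolubVanLoan2013, §11.2.8] -/
def chebTau (c cmax : ℝ) (n : ℕ) : ℝ := (Chebyshev.T ℝ (n : ℤ)).eval (chebMu c cmax)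

/-- Evaluation of the affine map. [folklore] -/
private theorem eval_chebAffine (c cmax x : ℝ) :
    (chebAffine c cmax).eval x = (cmax + c - 2 * x) / (cmax - c) := by
  simp only [chebAffine, eval_sub, eval_C, eval_mul, eval_X]
  ring

/-- `s(0) = μ`. [folklore] -/
private theorem eval_chebAffine_zero (c cmax : ℝ) : (chebAffine c cmax).eval 0 = chebMu c cmax := by
  rw [eval_chebAffine, chebMu]
  ring

/-- `s` maps `[c, cmax]` into `[-1, 1]` (Golub–Van Loan (2013) §11.2.8: the argument of `c_k` lies in
`[-1, 1]` on `[α, β]`). [cite: GolubVanLoan2013, §11.2.8] -/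
theorem abs_eval_chebAffine_le_one {c cmax : ℝ} (hcm : c < cmax) {x : ℝ} (hx : x ∈ Set.Icc c cmax) :
    |(chebAffine c cmax).eval x| ≤ 1 := by
  have hd : 0 < cmax - c := sub_pos.mpr hcm
  rw [eval_chebAffine, abs_div, abs_of_pos hd, div_le_one hd, abs_le]
  obtain ⟨h1, h2⟩ := hx
  constructor <;> linarith

/-- `1 < μ` for `0 < c < cmax`. [folklore] -/
private theorem one_lt_chebMu {c cmax : ℝ} (hc : 0 < c) (hcm : c < cmax) : 1 < chebMu c cmax := by
  have hd : 0 < cmax - c := sub_pos.mpr hcm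
  rw [chebMu, one_lt_div hd]
  linarith

/-- `1 < τ = T_n(μ)` for `n ≠ 0`, `0 < c < cmax` (Chebyshev polynomials exceed `1` outside `[-1, 1]`).
[cite: GolubVanLoan2013, §11.2.8] -/
theorem one_lt_chebTau {c cmax : ℝ} (hc : 0 < c) (hcm : c < cmax) {n : ℕ} (hn : n ≠ 0) :
    1 < chebTau c cmax n :=
  Chebyshev.one_lt_eval_T_real (by exact_mod_cast hn) (one_lt_chebMu hc hcm)

/-! ### The residual polynomial `q_n` and the inverse polynomial `p_n` -/

/-- The Chebyshev residual polynomial `q_n(X) = T_n(s(X)) / T_n(μ)`: value `1` at `0`, modulus `≤ 1/T_n(μ)`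
on `[c, cmax]`. Golub–Van Loan (2013) §11.2.8, the polynomial `p_k(z) = c_k(…)/c_k(μ)`.
[cite: GolubVanLoan2013, §11.2.8] -/
def chebResidual (c cmax : ℝ) (n : ℕ) : ℝ[X] :=
  C (chebTau c cmax n)⁻¹ * (Chebyshev.T ℝ (n : ℤ)).comp (chebAffine c cmax)

/-- The Chebyshev inverse polynomial `p_n = (1 − q_n) / ((1 − 1/τ) · X)` (a genuine polynomial since
`q_n(0) = 1`), of degree `n − 1`. [cite: GolubVanLoan2013, §11.2.8] -/
def chebInvPoly (c cmax : ℝ) (n : ℕ) : ℝ[X] :=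
  C (1 - (chebTau c cmax n)⁻¹)⁻¹ * divX (1 - chebResidual c cmax n)

/-- Evaluation of `q_n`. [folklore] -/
private theorem eval_chebResidual (c cmax : ℝ) (n : ℕ) (x : ℝ) :
    (chebResidual c cmax n).eval x =
      (chebTau c cmax n)⁻¹ * (Chebyshev.T ℝ (n : ℤ)).eval ((chebAffine c cmax).eval x) := by
  simp only [chebResidual, eval_mul, eval_C, eval_comp]

/-- `q_n(0) = 1` (normalisation at the shift point). [cite: GolubVanLoan2013, §11.2.8] -/
theorem eval_chebResidual_zero {c cmax : ℝ} {n : ℕ} (hτ : chebTau c cmax n ≠ 0) :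
    (chebResidual c cmax n).eval 0 = 1 := by
  rw [eval_chebResidual, eval_chebAffine_zero, ← chebTau, inv_mul_cancel₀ hτ]

/-- `|q_n(x)| ≤ 1/τ` on `[c, cmax]` (Chebyshev polynomials are bounded by `1` on `[-1, 1]`).
[cite: GolubVanLoan2013, §11.2.8] -/
theorem abs_eval_chebResidual_le {c cmax : ℝ} (hcm : c < cmax) {n : ℕ} (hτ : 0 < chebTau c cmax n)
    {x : ℝ} (hx : x ∈ Set.Icc c cmax) :
    |(chebResidual c cmax n).eval x| ≤ (chebTau c cmax n)⁻¹ := by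
  rw [eval_chebResidual, abs_mul, abs_of_pos (inv_pos.mpr hτ)]
  exact mul_le_of_le_one_right (inv_pos.mpr hτ).le
    (Chebyshev.abs_eval_T_real_le_one _ (abs_eval_chebAffine_le_one hcm hx))

/-- The defining identity of `p_n`: `x · p_n(x) = (1 − q_n(x)) / (1 − 1/τ)` (residual polynomial ↔
polynomial approximate inverse, `1 − x·p(x) = ` normalised residual). [cite: GolubVanLoan2013, §11.2.8] -/
theorem mul_eval_chebInvPoly {c cmax : ℝ} {n : ℕ} (hτ : chebTau c cmax n ≠ 0) (x : ℝ) :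
    x * (chebInvPoly c cmax n).eval x =
      (1 - (chebTau c cmax n)⁻¹)⁻¹ * (1 - (chebResidual c cmax n).eval x) := by
  have h := congrArg (Polynomial.eval x) (Polynomial.divX_mul_X_add (1 - chebResidual c cmax n))
  rw [eval_add, eval_mul, eval_X, eval_C, coeff_zero_eq_eval_zero, eval_sub, eval_one,
    eval_chebResidual_zero hτ, sub_self, add_zero, eval_sub, eval_one] at h
  simp only [chebInvPoly, eval_mul, eval_C]
  rw [← h]
  ring

/-- **`1/x ≤ p_n(x)` on `[c, cmax]`** for the explicit Chebyshev inverse polynomial (`0 < c < cmax`,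
`n ≥ 1`): exactly the hypothesis `hp` of
`Literature.Analysis.OperatorTheory.fromBlocks_dotProduct_nonneg_of_schur_poly_cert`.
[cite: GolubVanLoan2013, §11.2.8] -/
theorem one_div_le_eval_chebInvPoly {c cmax : ℝ} (hc : 0 < c) (hcm : c < cmax) {n : ℕ} (hn : n ≠ 0) :
    ∀ x ∈ Set.Icc c cmax, 1 / x ≤ (chebInvPoly c cmax n).eval x := by
  intro x hx
  have hτ1 : 1 < chebTau c cmax n := one_lt_chebTau hc hcm hn
  have hτ0 : 0 < chebTau c cmax n := zero_lt_one.trans hτ1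
  have hε : (chebTau c cmax n)⁻¹ < 1 := inv_lt_one_of_one_lt₀ hτ1
  have hk : 0 < 1 - (chebTau c cmax n)⁻¹ := sub_pos.mpr hε
  have hxpos : 0 < x := hc.trans_le hx.1
  have hq : (chebResidual c cmax n).eval x ≤ (chebTau c cmax n)⁻¹ :=
    (le_abs_self _).trans (abs_eval_chebResidual_le hcm hτ0 hx)
  rw [div_le_iff₀ hxpos, mul_comm, mul_eval_chebInvPoly hτ0.ne' x]
  calc (1 : ℝ) = (1 - (chebTau c cmax n)⁻¹)⁻¹ * (1 - (chebTau c cmax n)⁻¹) :=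
        (inv_mul_cancel₀ hk.ne').symm
    _ ≤ (1 - (chebTau c cmax n)⁻¹)⁻¹ * (1 - (chebResidual c cmax n).eval x) :=
        mul_le_mul_of_nonneg_left (by linarith) (inv_pos.mpr hk).le

/-- **Quality of `p_n`**: on `[c, cmax]`, `0 ≤ x · p_n(x) − 1 ≤ (2/τ)/(1 − 1/τ)` with `τ = T_n(μ)`
(so `p_n(x) − 1/x ≤ (1/x) · (2/τ)/(1 − 1/τ) → 0` geometrically in `n`, ratio `μ − √(μ² − 1)`).
[cite: GolubVanLoan2013, §11.2.8] -/
theorem mul_eval_chebInvPoly_sub_one_mem {c cmax : ℝ} (hc : 0 < c) (hcm : c < cmax) {n : ℕ}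
    (hn : n ≠ 0) {x : ℝ} (hx : x ∈ Set.Icc c cmax) :
    x * (chebInvPoly c cmax n).eval x - 1 ∈
      Set.Icc 0 (2 * (chebTau c cmax n)⁻¹ / (1 - (chebTau c cmax n)⁻¹)) := by
  have hτ1 : 1 < chebTau c cmax n := one_lt_chebTau hc hcm hn
  have hτ0 : 0 < chebTau c cmax n := zero_lt_one.trans hτ1
  have hε : (chebTau c cmax n)⁻¹ < 1 := inv_lt_one_of_one_lt₀ hτ1
  have hk : 0 < 1 - (chebTau c cmax n)⁻¹ := sub_pos.mpr hε
  have hq := abs_le.mp (abs_eval_chebResidual_le hcm hτ0 hx)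
  have hid : x * (chebInvPoly c cmax n).eval x - 1 =
      (1 - (chebTau c cmax n)⁻¹)⁻¹ * ((chebTau c cmax n)⁻¹ - (chebResidual c cmax n).eval x) := by
    rw [mul_eval_chebInvPoly hτ0.ne' x]
    have : (1 - (chebTau c cmax n)⁻¹)⁻¹ * (1 - (chebTau c cmax n)⁻¹) = 1 := inv_mul_cancel₀ hk.ne'
    linear_combination this
  rw [hid, Set.mem_Icc]
  refine ⟨mul_nonneg (inv_pos.mpr hk).le (by linarith [hq.2]), ?_⟩
  rw [div_eq_mul_inv, mul_comm (2 * (chebTau c cmax n)⁻¹)]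
  exact mul_le_mul_of_nonneg_left (by linarith [hq.1]) (inv_pos.mpr hk).le

/-! ### Certificate form: weighted sums of squares on the interval (arbitrary `p`) -/

/-- **Interval sum-of-squares certificate for `1/x ≤ p(x)`.** If `X·p − 1 = Σᵢ aᵢ gᵢ² + (X − c)(cmax − X)·Σⱼ bⱼ hⱼ²`
with nonnegative weights, then `1/x ≤ p(x)` for every `x ∈ [c, cmax]` (`0 < c`). The trivial direction of
the univariate Positivstellensatz on a compact interval (Lukács–Markov); complete by the non-trivial
direction (Markov–Lukács: Blekherman–Parrilo–Thomas (2012) Thm 3.72, even-degree case; Marshall (2008)),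
which is not needed here. [cite: BlekhermanParriloThomas2012, Thm 3.72] -/
theorem one_div_le_eval_of_interval_sos {ι κ : Type*} (s : Finset ι) (t : Finset κ) {c cmax : ℝ}
    (hc : 0 < c) (p : ℝ[X]) (a : ι → ℝ) (g : ι → ℝ[X]) (b : κ → ℝ) (h : κ → ℝ[X])
    (ha : ∀ i ∈ s, 0 ≤ a i) (hb : ∀ j ∈ t, 0 ≤ b j)
    (hid : X * p - 1 =
      (∑ i ∈ s, C (a i) * g i ^ 2) + (X - C c) * (C cmax - X) * ∑ j ∈ t, C (b j) * h j ^ 2) :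
    ∀ x ∈ Set.Icc c cmax, 1 / x ≤ p.eval x := by
  intro x hx
  have hxpos : 0 < x := hc.trans_le hx.1
  have he := congrArg (Polynomial.eval x) hid
  simp only [eval_sub, eval_mul, eval_X, eval_one, eval_add, eval_finsetSum, eval_C, eval_pow] at he
  have h1 : 0 ≤ ∑ i ∈ s, a i * (g i).eval x ^ 2 :=
    Finset.sum_nonneg fun i hi => mul_nonneg (ha i hi) (sq_nonneg _)
  have h2 : 0 ≤ ∑ j ∈ t, b j * (h j).eval x ^ 2 :=
    Finset.sum_nonneg fun j hj => mul_nonneg (hb j hj) (sq_nonneg _)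
  have h3 : 0 ≤ (x - c) * (cmax - x) := mul_nonneg (sub_nonneg.mpr hx.1) (sub_nonneg.mpr hx.2)
  rw [div_le_iff₀ hxpos, mul_comm]
  nlinarith [mul_nonneg h3 h2]

/-! ### Corollary: the Chebyshev-filtered Schur-complement inertia certificate -/

/-- **Chebyshev-filtered inertia certificate (counting form), no analytic side condition.** For a real
symmetric block matrix `[[A, B], [Bᵀ, D]]` with `c•1 ⪯ A ⪯ cmax•1`, `0 < c < cmax`, `n ≥ 1`, and ONE verified
positive-semidefiniteness `D − Bᵀ p_n(A) B + Σ_j t_j q_j q_jᵀ ⪰ 0` for the explicit polynomial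
`p_n = chebInvPoly c cmax n`, the block form is nonnegative on `{(x, y) : q_j ⬝ y = 0 ∀ j}` (codimension `≤ k`:
at most `k` negative eigenvalues). `fromBlocks_dotProduct_nonneg_of_schur_poly_cert` ∘
`one_div_le_eval_chebInvPoly`. [cite: Haynsworth1968, Thm 1] [cite: GolubVanLoan2013, §11.2.8] -/
theorem fromBlocks_dotProduct_nonneg_of_chebyshev_schur_cert {m m' : Type*} [Fintype m] [Fintype m']
    [DecidableEq m] {k : ℕ} (A : Matrix m m ℝ) (B : Matrix m m' ℝ) (D : Matrix m' m' ℝ) {c cmax : ℝ}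
    {n : ℕ} (t : Fin k → ℝ) (q : Fin k → m' → ℝ) (hc : 0 < c) (hcm : c < cmax) (hn : n ≠ 0)
    (hAc : (A - c • (1 : Matrix m m ℝ)).PosSemidef)
    (hAcmax : (cmax • (1 : Matrix m m ℝ) - A).PosSemidef)
    (hcert : (D - Bᵀ * (aeval A (chebInvPoly c cmax n)) * B +
      ∑ j, t j • Matrix.vecMulVec (q j) (q j)).PosSemidef)
    (x : m → ℝ) (y : m' → ℝ) (hy : ∀ j, q j ⬝ᵥ y = 0) :
    0 ≤ (Sum.elim x y) ⬝ᵥ (Matrix.fromBlocks A B Bᵀ D *ᵥ (Sum.elim x y)) :=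
  Literature.Analysis.OperatorTheory.fromBlocks_dotProduct_nonneg_of_schur_poly_cert A B D c cmax
    (chebInvPoly c cmax n) t q hc hAc hAcmax (one_div_le_eval_chebInvPoly hc hcm hn) hcert x y hy

end

end Literature.Analysis.ValidatedNumerics
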